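import Summits.Parity.GeneralizedHardyLittlewood.Theorems.LeeYangFibresCellParityLawInductionDefs
import Summits.Parity.GeneralizedHardyLittlewood.Theorems.LeeYangFibresCellParityLawKernelInductionSums
import Summits.Parity.GeneralizedHardyLittlewood.Theorems.LeeYangFibresCellParityLawKernelInductionStep
import Summits.Parity.GeneralizedHardyLittlewood.Theorems.LeeYangFibresCellParityLawFibreInheritance
import Summits.Parity.GeneralizedHardyLittlewood.Theorems.LeeYangFibresCellParityLawInductionFibreRanges
import Summits.Parity.GeneralizedHardyLittlewood.Theorems.LeeYangFibresCellParityLawInductionSumRestrict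
import Summits.Parity.GeneralizedHardyLittlewood.Theorems.LeeYangFibresCellParityLawInductionStepBudget
import HarnessLib

/-!
# Route `LeeYangFibres`, crux `CellParityLaw` (stmt-Parity-14109), line `section-annihilator`:
# the induction step `Q(1) ∧ Q(n) ⟹ Q(n+1)` (`stub_inductionStep`, skeleton v19c)

Skeleton v19 (lead c6). The kernel `EffectiveRoughCellLawStrong` is proved by induction on the cell index of the
explicit-parameter law `Q(m) = CellLawAt m` (`…InductionDefs`, p127248). This file is the STEP (Bombieri, RIMS
Kôkyûroku 294 (1977) p. 5, organised along the least prime factor): for `n ≥ 2`,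

* the exact recursion `C_{n+1}(𝒜; x, z) = Σ_{z<p≤x} C_n(𝒜_p; x/p, p − 1/2)` (`RecursionIdentity`), in which only
  the primes `p ≤ x^{1/(n+1)}` contribute (`InductionStepAux.stub_sumRestrict`);
* each fibre `𝒜_p` is kernel-admissible data at `(x/p, p − 1/2, η_p = η log x/log(x/p), Λ, w₀, R_p)` in the same
  roughness class (`FibreInheritance`, `InductionStepAux.stub_fibreRanges`), so `Q(n)` and `Q(1)` apply to it with
  ITS OWN clipped parameter `δ*_p`; the pointwise consequence
  `|C_n(𝒜_p) − I_n(u_p)((1 + (−1)^n) e^γ V(p) A_p(x)/u_p − (−1)^n π_p)| ≤ E_p + (u+1) E¹_p + junk_p`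
  is the landed `StepAux.fibre_pointwise` (shift `log(p − 1/2) ↦ log p` included);
* summed over `p`: `Σ_p I_n(u_p) e^γ V(p) A_p(x)/u_p ≈ I_{n+1}(u') T` (`ModelPrimeSum`) and
  `Σ_p I_n(u_p) π_p = weightedPairSum 𝒜 x z n ≈ I_{n+1}(u')(2T − C₁)` (`EffectiveWeightedP2Law` at `j = n`);
* the parity algebra at the parent (`StepAux.parent_bound`) with the clip defect `|C₁ − (2 − δ*) T| ≤ (C₁ − 2T)⁺
  ≤ kernelErr` (`PrimeUpperBound`), the fibre error sums (`SumsAux.fibre_errors_sum`, twice) and the conversion of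
  the raw total into one currency (`InductionStepAux.stub_stepBudget`).

Constants of `Q(n+1)`: `κ = min(κ_n, κ_1, κ_P, κ_U, 1)`, `A₂ = A₂ⁿ + A₂¹ + A_F + A₂ᴾ + A₂ᵁ`,
`η₀ = min((2/3)η₀ⁿ, (2/3)η₀¹, η₀ᴾ, η₀ᵁ, 1/(4u))` (the fibres' deficits are `≤ (3/2)η`), `x₀ = max(exp(4(u+1)²),
(x₀ⁿ)², (x₀¹)², x₀ᴹ, x₀ᴾ, x₀ᵁ)` (the fibres live at scales `≥ x^{1/2}`).

References: E. Bombieri, RIMS Kôkyûroku 294 (1977) p. 5 [BombieriRIMS1977]; E. Bombieri, Rend. Accad. Naz. XL (5)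
1/2 (1975/76) [BombieriAsymptoticSieve1976].
-/

noncomputable section

open scoped BigOperators Classical
open Finset Literature.NumberTheory.Sieve

namespace Summit.Parity.GeneralizedHardyLittlewood.Cruxes.CellParityLaw.SectionAnnihilator

namespace InductionStepAux

/-- **Basic facts on admissible data in range** (scales, logarithms, signs): for `u ≥ 2`,
`x ≥ exp(4(u+1)²)`, `z ∈ [x^{1/(u+1)}, x^{1/2}]`, parameters in range with `η₀ ≤ 1/(4u)` and admissible `𝒜`. -/
theorem data_facts {u : ℕ} (hu : 2 ≤ u) {A₁ L' : ℝ} {𝒜 : SieveSequence} {x z η Λ w₀ R η₀ : ℝ}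
    (hxexp : Real.exp (4 * ((u : ℝ) + 1) ^ 2) ≤ x) (hzlo : x ^ (1 / ((u : ℝ) + 1)) ≤ z)
    (hzhi : z ≤ x ^ (1 / 2 : ℝ)) (hKR : KernelRanges x η Λ w₀ η₀) (hη₀4 : η₀ ≤ 1 / (4 * (u : ℝ)))
    (hKA : KernelAdmissible A₁ L' 𝒜 x η Λ w₀ R) :
    0 < x ∧ 1 < x ∧ 36 ≤ Real.log x ∧ 0 < z ∧ Real.log x / ((u : ℝ) + 1) ≤ Real.log z ∧
    Real.log z ≤ Real.log x / 2 ∧ 12 ≤ Real.log z ∧ Real.exp 1 ≤ z ∧ z ≤ x ∧ Real.exp 1 ≤ x ∧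
    0 < η ∧ η ≤ 1 / (4 * (u : ℝ)) ∧ η ≤ 1 / 2 ∧ 0 ≤ R ∧
    0 < 𝒜.densityProduct (primesProdBelow z) ∧ 0 ≤ 𝒜.size x ∧ 𝒜.size x ≤ x ∧
    2 ≤ Real.log x / Real.log z ∧ Real.log x / Real.log z ≤ (u : ℝ) + 1 ∧
    0 ≤ primeMain 𝒜 x z ∧ (primeMain 𝒜 x z = 0 → roughCellSum 𝒜 x z 1 = 0) ∧
    0 ≤ roughCellSum 𝒜 x z 1 ∧ roughCellSum 𝒜 x z 1 ≤ 𝒜.size x := by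
  obtain ⟨hηlo, hηhi, _, _, _, _⟩ := hKR
  obtain ⟨ha1, _, _, hsize, _, hdim, _, hTI⟩ := hKA
  have hu2 : (2 : ℝ) ≤ u := by exact_mod_cast hu
  have hu10 : (0 : ℝ) < (u : ℝ) + 1 := by linarith
  have hx0 : 0 < x := (Real.exp_pos _).trans_le hxexp
  have hlx : 4 * ((u : ℝ) + 1) ^ 2 ≤ Real.log x := by
    rw [← Real.log_exp (4 * ((u : ℝ) + 1) ^ 2)]; exact Real.log_le_log (Real.exp_pos _) hxexp
  have hsq : (9 : ℝ) ≤ ((u : ℝ) + 1) ^ 2 := by nlinarith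
  have hlx36 : 36 ≤ Real.log x := by linarith
  have hx1 : 1 < x := by
    by_contra h
    have := Real.log_nonpos hx0.le (not_lt.mp h)
    linarith
  have hz0 : 0 < z := (Real.rpow_pos_of_pos hx0 _).trans_le hzlo
  have hlzlo : Real.log x / ((u : ℝ) + 1) ≤ Real.log z := by
    have h := Real.log_le_log (Real.rpow_pos_of_pos hx0 _) hzlo
    rw [Real.log_rpow hx0] at h
    calc Real.log x / ((u : ℝ) + 1) = 1 / ((u : ℝ) + 1) * Real.log x := by ring
      _ ≤ Real.log z := h
  have hlzhi : Real.log z ≤ Real.log x / 2 := by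
    have h := Real.log_le_log hz0 hzhi
    rw [Real.log_rpow hx0] at h
    linarith
  have hlz12 : 12 ≤ Real.log z := by
    refine le_trans ?_ hlzlo
    rw [le_div_iff₀ hu10]
    have h3 : (3 : ℝ) ≤ (u : ℝ) + 1 := by linarith
    have : 12 * ((u : ℝ) + 1) ≤ Real.log x := le_trans (by nlinarith) hlx
    linarith
  have hez : Real.exp 1 ≤ z := by
    rw [← Real.le_log_iff_exp_le hz0]; linarith
  have hzx : z ≤ x := by
    calc z ≤ x ^ (1 / 2 : ℝ) := hzhi
      _ ≤ x ^ (1 : ℝ) := Real.rpow_le_rpow_of_exponent_le hx1.le (by norm_num)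
      _ = x := Real.rpow_one x
  have hlogx0 : 0 < Real.log x := by linarith
  have hη0 : 0 < η := (Real.rpow_pos_of_pos hlogx0 _).trans_le hηlo
  have hη4 : η ≤ 1 / (4 * (u : ℝ)) := hηhi.trans hη₀4
  have hη8 : η ≤ 1 / 8 := hη4.trans (by rw [div_le_div_iff₀ (by positivity) (by norm_num)]; linarith)
  have hR0 : 0 ≤ R :=
    le_trans (Finset.sum_nonneg fun _ _ => abs_nonneg _) (hTI (fun _ => x) fun _ => le_rfl)
  have hVpos : 0 < 𝒜.densityProduct (primesProdBelow z) := hdim.densityProduct_pos z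
  have hA0 : 0 ≤ 𝒜.size x := by rw [hsize]; exact Finset.sum_nonneg fun q _ => 𝒜.a_nonneg q
  have hAx : 𝒜.size x ≤ x := StepAux.size_le_self 𝒜 hx0.le ha1 hsize
  have hlz0 : 0 < Real.log z := by linarith
  have hu'2 : 2 ≤ Real.log x / Real.log z := by rw [le_div_iff₀ hlz0]; linarith
  have hu'le : Real.log x / Real.log z ≤ (u : ℝ) + 1 := by
    rw [div_le_iff₀ hlz0]
    rw [div_le_iff₀ hu10] at hlzlo
    linarith
  have hu'0 : 0 < Real.log x / Real.log z := by linarith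
  have hT0 : 0 ≤ primeMain 𝒜 x z := by unfold primeMain; positivity
  obtain ⟨hC₁0, hC₁A⟩ := StepAux.roughCellSum_le_size 𝒜 x z 1 hsize
  have hTC : primeMain 𝒜 x z = 0 → roughCellSum 𝒜 x z 1 = 0 := by
    intro hT
    unfold primeMain at hT
    have hG0 : 0 < Real.exp Real.eulerMascheroniConstant := Real.exp_pos _
    have hA00 : 𝒜.size x = 0 := by
      rcases mul_eq_zero.mp ((div_eq_zero_iff.mp hT).resolve_right hu'0.ne') with h | h
      · rcases mul_eq_zero.mp h with h' | h'
        · exact absurd h' hG0.ne'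
        · exact absurd h' hVpos.ne'
      · exact h
    linarith
  exact ⟨hx0, hx1, hlx36, hz0, hlzlo, hlzhi, hlz12, hez, hzx, hez.trans hzx, hη0, hη4, by linarith, hR0,
    hVpos, hA0, hAx, hu'2, hu'le, hT0, hTC, hC₁0, hC₁A⟩

end InductionStepAux

open InductionStepAux in
/-- **`stub_inductionStep`** (registered stub of skeleton v19c, line `section-annihilator`): the step
`Q(1) ∧ Q(n) ⟹ Q(n+1)` (`n ≥ 2`) of the induction behind `KernelInduction` — recursion over the least prime factor,
the induction hypotheses at each fibre with its own clipped parity parameter, the model prime sum, the weighted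
`P₂` law at `j = n`, the parity algebra at the parent and the error budget. See the module docstring. -/
theorem stub_inductionStep : InductionStep := by
  intro n hn hPUB hRec hFib hMod hP2 hQ1 hQn u A₁ L' hu
  -- constants of the inputs
  obtain ⟨κn, Cn, η₀n, A₂n, x₀n, hκn, hκn1, hCn, hη₀n, hLn⟩ := hQn u A₁ L' hu
  obtain ⟨κ1, C1, η₀1, A₂1, x₀1, hκ1, hκ11, hC1, hη₀1, hL1⟩ := hQ1 u A₁ L' hu
  obtain ⟨CF, AF, hCF, hF⟩ := hFib A₁ L'
  obtain ⟨CM, x₀M, hCM, hM⟩ := hMod u A₁ L' hu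
  obtain ⟨κP, CP, η₀P, A₂P, x₀P, hκP, hCP, hη₀P, hP⟩ := hP2 u A₁ L' hu
  obtain ⟨κU, CU, η₀U, A₂U, x₀U, hκU, hCU, hη₀U, hU⟩ := hPUB u A₁ L' hu
  have hu2 : (2 : ℝ) ≤ u := by exact_mod_cast hu
  have hu10 : (0 : ℝ) < (u : ℝ) + 1 := by linarith
  -- output constants
  obtain ⟨κ, hκdef⟩ : ∃ κ : ℝ, κ = min (min κn κ1) (min (min κP κU) 1) := ⟨_, rfl⟩
  obtain ⟨C, hCdef⟩ : ∃ C : ℝ, C = ((u : ℝ) + 2) * (14 + CF) * (Cn + C1) + 160 * ((u : ℝ) + 1) + 4 * CM +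
    CP + ((u : ℝ) + 1) * CU := ⟨_, rfl⟩
  obtain ⟨η₀, hη₀def⟩ : ∃ η₀ : ℝ,
    η₀ = min (min (2 / 3 * η₀n) (2 / 3 * η₀1)) (min (min η₀P η₀U) (1 / (4 * (u : ℝ)))) := ⟨_, rfl⟩
  obtain ⟨x₀, hx₀def⟩ : ∃ x₀ : ℝ, x₀ = max (Real.exp (4 * ((u : ℝ) + 1) ^ 2))
    (max (max (x₀n ^ 2) (x₀1 ^ 2)) (max x₀M (max x₀P x₀U))) := ⟨_, rfl⟩
  have hκpos : 0 < κ := by rw [hκdef]; exact lt_min (lt_min hκn hκ1) (lt_min (lt_min hκP hκU) one_pos)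
  have hκle1 : κ ≤ 1 := by rw [hκdef]; exact (min_le_right _ _).trans (min_le_right _ _)
  have hκn' : κ ≤ κn := by rw [hκdef]; exact (min_le_left _ _).trans (min_le_left _ _)
  have hκ1' : κ ≤ κ1 := by rw [hκdef]; exact (min_le_left _ _).trans (min_le_right _ _)
  have hκP' : κ ≤ κP := by
    rw [hκdef]; exact (min_le_right _ _).trans ((min_le_left _ _).trans (min_le_left _ _))
  have hκU' : κ ≤ κU := by
    rw [hκdef]; exact (min_le_right _ _).trans ((min_le_left _ _).trans (min_le_right _ _))
  have hC0 : 0 ≤ C := by rw [hCdef]; positivity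
  have hη₀pos : 0 < η₀ := by rw [hη₀def]; positivity
  refine ⟨κ, C, η₀, A₂n + A₂1 + AF + A₂P + A₂U, x₀, hκpos, hκle1, hC0, hη₀pos, ?_⟩
  intro 𝒜 x z η Λ w₀ R hx hzlo hzhi hKR hKA
  obtain ⟨hηlo, hηhi, hΛ1, hΛx, hw2, hwx⟩ := hKR
  obtain ⟨ha1, hax, haΛ, hsize, hgA, hdim, hMert, hTI⟩ := id hKA
  have hg := hdim.1
  /- thresholds on the constants -/
  rw [hx₀def] at hx
  have hxexp : Real.exp (4 * ((u : ℝ) + 1) ^ 2) ≤ x := (le_max_left _ _).trans hx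
  have hx₀n : x₀n ^ 2 ≤ x :=
    ((le_max_left _ _).trans ((le_max_left _ _).trans (le_max_right _ _))).trans hx
  have hx₀1 : x₀1 ^ 2 ≤ x :=
    ((le_max_right _ _).trans ((le_max_left _ _).trans (le_max_right _ _))).trans hx
  have hx₀M : x₀M ≤ x := ((le_max_left _ _).trans ((le_max_right _ _).trans (le_max_right _ _))).trans hx
  have hx₀P : x₀P ≤ x :=
    ((le_max_left _ _).trans ((le_max_right _ _).trans ((le_max_right _ _).trans (le_max_right _ _)))).trans hx
  have hx₀U : x₀U ≤ x :=
    ((le_max_right _ _).trans ((le_max_right _ _).trans ((le_max_right _ _).trans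
      (le_max_right _ _)))).trans hx
  have hη₀n' : 3 / 2 * η₀ ≤ η₀n := by
    have : η₀ ≤ 2 / 3 * η₀n := by rw [hη₀def]; exact (min_le_left _ _).trans (min_le_left _ _)
    linarith
  have hη₀1' : 3 / 2 * η₀ ≤ η₀1 := by
    have : η₀ ≤ 2 / 3 * η₀1 := by rw [hη₀def]; exact (min_le_left _ _).trans (min_le_right _ _)
    linarith
  have hη₀P' : η₀ ≤ η₀P := by
    rw [hη₀def]; exact (min_le_right _ _).trans ((min_le_left _ _).trans (min_le_left _ _))
  have hη₀U' : η₀ ≤ η₀U := by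
    rw [hη₀def]; exact (min_le_right _ _).trans ((min_le_left _ _).trans (min_le_right _ _))
  have hη₀4 : η₀ ≤ 1 / (4 * (u : ℝ)) := by rw [hη₀def]; exact (min_le_right _ _).trans (min_le_right _ _)
  /- basic facts on the data -/
  have hKR0 : KernelRanges x η Λ w₀ η₀ := ⟨hηlo, hηhi, hΛ1, hΛx, hw2, hwx⟩
  obtain ⟨hx0, hx1, hlx36, hz0, hlzlo, hlzhi, hlz12, hez, hzx, hex, hη0, hη4, hηhalf, hR0, hVpos, hA0, hAx,
    hu'2, hu'le, hT0, hTC, hC₁0, hC₁A⟩ := data_facts hu hxexp hzlo hzhi hKR0 hη₀4 hKA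
  have hlz0 : 0 < Real.log z := by linarith
  -- ranges at the weaker thresholds used by the inputs
  have hKR4 : KernelRanges x η Λ w₀ (1 / (4 * (u : ℝ))) := ⟨hηlo, hη4, hΛ1, hΛx, hw2, hwx⟩
  have hKRP : KernelRanges x η Λ w₀ η₀P := ⟨hηlo, hηhi.trans hη₀P', hΛ1, hΛx, hw2, hwx⟩
  have hKRU : KernelRanges x η Λ w₀ η₀U := ⟨hηlo, hηhi.trans hη₀U', hΛ1, hΛx, hw2, hwx⟩
  /- the prime sets and the restriction of the sums -/
  obtain ⟨hresC, hresW, hPmem, hPQ⟩ := stub_sumRestrict 𝒜 x z n (by omega) hz0.le hx1.le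
  set Q := (Finset.Ioc 0 ⌊x⌋₊).filter (fun p : ℕ => p.Prime ∧ z < (p : ℝ)) with hQdef
  set P := (Finset.Ioc ⌊z⌋₊ ⌊x ^ (1 / ((n : ℝ) + 1))⌋₊).filter Nat.Prime with hPdef
  /- fibre Type-I data -/
  have he1 : (2 : ℝ) ≤ Real.exp 1 := by have := Real.exp_one_gt_d9; linarith
  obtain ⟨Rp, hRp0, hRpsum, hRpadm⟩ :=
    hF 𝒜 x z η Λ w₀ R (he1.trans hex) (by linarith [he1.trans hez]) hη0 hηhalf hR0 hKA
  /- notation per prime -/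
  set G : ℝ := Real.exp Real.eulerMascheroniConstant with hGdef
  set πp : ℕ → ℝ := fun p => roughCellSum (fibreSeq 𝒜 p) (x / p) ((p : ℝ) - 1 / 2) 1 with hπpdef
  set Cnp : ℕ → ℝ := fun p => roughCellSum (fibreSeq 𝒜 p) (x / p) ((p : ℝ) - 1 / 2) n with hCnpdef
  set Vp : ℕ → ℝ := fun p => 𝒜.densityProduct (primesProdBelow (p : ℝ)) with hVpdef
  set Bp : ℕ → ℝ := fun p => 𝒜.congrSum p x with hBpdef
  set uu : ℕ → ℝ := fun p => Real.log (x / p) / Real.log p with huudef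
  set Ep : ℕ → ℝ := fun p =>
    kernelErr Cn κn A₂n (fibreSeq 𝒜 p) (x / p) ((p : ℝ) - 1 / 2) (η * Real.log x / Real.log (x / p)) Λ (Rp p)
    with hEpdef
  set E1p : ℕ → ℝ := fun p =>
    kernelErr C1 κ1 A₂1 (fibreSeq 𝒜 p) (x / p) ((p : ℝ) - 1 / 2) (η * Real.log x / Real.log (x / p)) Λ (Rp p)
    with hE1pdef
  set jk : ℕ → ℝ := fun p => 16 * ((u : ℝ) + 1) / p * (2 * (Vp p * Bp p) + πp p) with hjkdef
  set f : ℕ → ℝ := fun p =>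
    roughCellDensity n (uu p) * ((1 + (-1 : ℝ) ^ n) * (G * Vp p * Bp p / uu p) - (-1 : ℝ) ^ n * πp p)
    with hfdef
  /- the pointwise fibre estimate -/
  have hpt : ∀ p ∈ P, |Cnp p - f p| ≤ (((u : ℝ) + 2) * Ep p + jk p) + (((u : ℝ) + 2) * E1p p + jk p) := by
    intro p hp
    obtain ⟨hpp, hzp, hpx⟩ := hPmem p hp
    obtain ⟨hp2, -, -, hp12, hxhalf, -, hth1, hth2, hKRn, hηp0, -, huu1, huus, husu, hshift⟩ :=
      stub_fibreRanges u n x z η Λ w₀ η₀ η₀n p hu hn hxexp hzlo hKR0 hη₀n' hpp hzp hpx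
    obtain ⟨-, -, -, -, -, -, -, -, hKR1, -⟩ :=
      stub_fibreRanges u n x z η Λ w₀ η₀ η₀1 p hu hn hxexp hzlo hKR0 hη₀1' hpp hzp hpx
    have hp0 : 0 < p := hpp.pos
    have hadm := hRpadm p hpp hzp hp12
    -- scales of the fibre
    have hsqrt : ∀ t : ℝ, t ^ 2 ≤ x → t ≤ x / p := by
      intro t ht
      refine le_trans ?_ hxhalf
      calc t ≤ |t| := le_abs_self _
        _ = Real.sqrt (t ^ 2) := (Real.sqrt_sq_eq_abs _).symm
        _ ≤ Real.sqrt x := Real.sqrt_le_sqrt ht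
        _ = x ^ (1 / 2 : ℝ) := Real.sqrt_eq_rpow x
    -- `Q(n)` and `Q(1)` at the fibre
    have hQnp := hLn (fibreSeq 𝒜 p) (x / p) ((p : ℝ) - 1 / 2) (η * Real.log x / Real.log (x / p)) Λ w₀ (Rp p)
      (hsqrt x₀n hx₀n) hth1 hth2 hKRn hadm
    have hQ1p := hL1 (fibreSeq 𝒜 p) (x / p) ((p : ℝ) - 1 / 2) (η * Real.log x / Real.log (x / p)) Λ w₀ (Rp p)
      (hsqrt x₀1 hx₀1) hth1 hth2 hKR1 hadm
    rw [FibreDataAux.fibre_primeMain 𝒜 hp0 x] at hQnp hQ1p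
    have hQ1p' : |πp p - (2 - cellDelta (fibreSeq 𝒜 p) (x / p) ((p : ℝ) - 1 / 2)) *
        roughCellDensity 1 (Real.log (x / p) / Real.log ((p : ℝ) - 1 / 2)) *
          (G * Vp p * Bp p / (Real.log (x / p) / Real.log ((p : ℝ) - 1 / 2)))| ≤ E1p p := by
      have e : (1 + (cellDelta (fibreSeq 𝒜 p) (x / p) ((p : ℝ) - 1 / 2) - 1) * (-1 : ℝ) ^ 1) =
          2 - cellDelta (fibreSeq 𝒜 p) (x / p) ((p : ℝ) - 1 / 2) := by ring
      rw [e] at hQ1p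
      exact hQ1p
    have hVp0 : 0 ≤ Vp p := (ModelPrimeSumAux.densityProduct_mem_Icc 𝒜 hg _).1
    have hBp0 : 0 ≤ Bp p := by
      simp only [hBpdef, SieveSequence.congrSum]
      exact Finset.sum_nonneg fun q _ => 𝒜.a_nonneg q
    have hπp0 : 0 ≤ πp p := by
      simp only [hπpdef, roughCellSum]
      exact Finset.sum_nonneg fun q _ => (fibreSeq 𝒜 p).a_nonneg q
    have key : |Cnp p - f p| ≤ Ep p + ((u : ℝ) + 1) * E1p p + 16 * ((u : ℝ) + 1) / p * (2 * Vp p * Bp p + πp p) :=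
      StepAux.fibre_pointwise (u := u) (n := n) (by omega) hp2 huu1 huus husu hshift hVp0 hBp0 hπp0 hQnp hQ1p'
    -- nonnegativity of the fibre currencies and of the junk
    have hzp1 : (1 : ℝ) < (p : ℝ) - 1 / 2 := by linarith
    have hxp1 : 1 ≤ x / p := le_trans (Real.one_le_rpow hx1.le (by norm_num)) hxhalf
    have hVf : 0 ≤ (fibreSeq 𝒜 p).densityProduct (primesProdBelow ((p : ℝ) - 1 / 2)) :=
      (ModelPrimeSumAux.densityProduct_mem_Icc (fibreSeq 𝒜 p) hg _).1
    have hAf : 0 ≤ (fibreSeq 𝒜 p).size (x / p) := by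
      rw [FibreInheritanceAux.fibreSeq_size]
      exact Finset.sum_nonneg fun q _ => (fibreSeq 𝒜 p).a_nonneg q
    have hEp0 : 0 ≤ Ep p :=
      KernelErrAux.kernelErr_nonneg hCn hηp0.le (by linarith) hzp1 hxp1 hVf hAf (hRp0 p)
    have hE1p0 : 0 ≤ E1p p :=
      KernelErrAux.kernelErr_nonneg hC1 hηp0.le (by linarith) hzp1 hxp1 hVf hAf (hRp0 p)
    have hjk0 : 0 ≤ jk p := by
      simp only [hjkdef]
      have hp0r : (0 : ℝ) < p := by exact_mod_cast hp0
      positivity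
    have hjk : 16 * ((u : ℝ) + 1) / p * (2 * Vp p * Bp p + πp p) = jk p := by
      simp only [hjkdef]; ring
    rw [hjk] at key
    have h1 : Ep p ≤ ((u : ℝ) + 2) * Ep p := le_mul_of_one_le_left hEp0 (by linarith)
    have h2 : ((u : ℝ) + 1) * E1p p ≤ ((u : ℝ) + 2) * E1p p := mul_le_mul_of_nonneg_right (by linarith) hE1p0
    linarith [key, h1, h2, hjk0]
  /- the cell through the recursion, and the sum of the pointwise estimates -/
  have hrec : roughCellSum 𝒜 x z (n + 1) = ∑ p ∈ P, Cnp p := by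
    rw [hRec 𝒜 x z n (by omega) hz0.le]; exact hresC
  have hf : ∑ p ∈ P, f p =
      (1 + (-1 : ℝ) ^ n) * (∑ p ∈ P, roughCellDensity n (uu p) * (G * Vp p * Bp p / uu p)) -
        (-1 : ℝ) ^ n * (∑ p ∈ P, roughCellDensity n (uu p) * πp p) := by
    rw [Finset.mul_sum, Finset.mul_sum, ← Finset.sum_sub_distrib]
    refine Finset.sum_congr rfl fun p _ => ?_
    simp only [hfdef]; ring
  have hF1 : |roughCellSum 𝒜 x z (n + 1) -
      ((1 + (-1 : ℝ) ^ n) * (∑ p ∈ P, roughCellDensity n (uu p) * (G * Vp p * Bp p / uu p)) -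
        (-1 : ℝ) ^ n * (∑ p ∈ P, roughCellDensity n (uu p) * πp p))| ≤
      (∑ p ∈ P, (((u : ℝ) + 2) * Ep p + jk p)) + ∑ p ∈ P, (((u : ℝ) + 2) * E1p p + jk p) := by
    rw [hrec, ← hf, ← Finset.sum_sub_distrib, ← Finset.sum_add_distrib]
    exact (Finset.abs_sum_le_sum_abs _ _).trans (Finset.sum_le_sum hpt)
  /- the fibre error sums -/
  have hP₁ : ((⌊x ^ (1 / ((n : ℝ) + 1))⌋₊ : ℕ) : ℝ) ≤ x ^ (1 / 3 : ℝ) := by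
    refine (Nat.floor_le (Real.rpow_nonneg hx0.le _)).trans ?_
    refine Real.rpow_le_rpow_of_exponent_le hx1.le ?_
    have hn3 : (3 : ℝ) ≤ (n : ℝ) + 1 := by
      have : (2 : ℝ) ≤ n := by exact_mod_cast hn
      linarith
    exact one_div_le_one_div_of_le (by norm_num) hn3
  have hRpP : ∑ p ∈ P, Rp p ≤ CF * Real.log x ^ AF * (R + x / z) :=
    (Finset.sum_le_sum_of_subset_of_nonneg hPQ fun p _ _ => hRp0 p).trans hRpsum
  have hπ0 : ∀ p, 0 ≤ πp p := fun p => by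
    simp only [hπpdef, roughCellSum]
    exact Finset.sum_nonneg fun q _ => (fibreSeq 𝒜 p).a_nonneg q
  have hπP : ∑ p ∈ P, πp p ≤ x := by
    have h2 : roughCellSum 𝒜 x z (1 + 1) = ∑ p ∈ Q, πp p := hRec 𝒜 x z 1 le_rfl hz0.le
    obtain ⟨-, hC2A⟩ := StepAux.roughCellSum_le_size 𝒜 x z (1 + 1) hsize
    calc ∑ p ∈ P, πp p ≤ ∑ p ∈ Q, πp p := Finset.sum_le_sum_of_subset_of_nonneg hPQ fun p _ _ => hπ0 p
      _ ≤ x := by rw [← h2]; exact hC2A.trans hAx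
  have hFSn := SumsAux.fibre_errors_sum (u := u) (A₂ := A₂n) 𝒜 Rp πp hCn hκn hκn1 hex hez hη0.le hηhalf hηlo hΛ1
    hg hTI hA0 (Finset.Subset.refl P) hP₁ hRp0 hRpP hπ0 hπP
  have hFS1 := SumsAux.fibre_errors_sum (u := u) (A₂ := A₂1) 𝒜 Rp πp hC1 hκ1 hκ11 hex hez hη0.le hηhalf hηlo hΛ1
    hg hTI hA0 (Finset.Subset.refl P) hP₁ hRp0 hRpP hπ0 hπP
  /- the model prime sum and the weighted `P₂` law, restricted to `P` -/
  have hST : ∑ p ∈ Q, roughCellDensity n (Real.log (x / p) / Real.log p) *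
        (Real.exp Real.eulerMascheroniConstant * 𝒜.densityProduct (primesProdBelow (p : ℝ)) *
          𝒜.congrSum p x / (Real.log (x / p) / Real.log p)) =
      ∑ p ∈ P, roughCellDensity n (uu p) * (G * Vp p * Bp p / uu p) :=
    hresW fun p => G * Vp p * Bp p / uu p
  have hMod' := hM 𝒜 x z η Λ w₀ R hx₀M hzlo hzhi hKR4 hKA n (by omega)
  rw [hST] at hMod'
  have hSπ : weightedPairSum 𝒜 x z n = ∑ p ∈ P, roughCellDensity n (uu p) * πp p := by
    rw [StepAux.weightedPairSum_eq_sum_fibre]; exact hresW πp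
  have hP2' := hP 𝒜 x z η Λ w₀ R hx₀P hzlo hzhi hKRP hKA n (by omega)
  rw [hSπ] at hP2'
  /- the clip defect at the parent -/
  have hU' := hU 𝒜 x z η Λ w₀ R hx₀U hzlo hzhi hKRU hKA
  have hkU0 : 0 ≤ kernelErr CU κU A₂U 𝒜 x z η Λ R :=
    KernelErrAux.kernelErr_nonneg hCU hη0.le (by linarith) (by linarith [he1.trans hez]) hx1.le hVpos.le hA0 hR0
  obtain ⟨-, -, hclip⟩ := StepAux.clip_defect_le hC₁0 hT0 hTC
  have hcd : |roughCellSum 𝒜 x z 1 - (2 - cellDelta 𝒜 x z) * primeMain 𝒜 x z| ≤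
      kernelErr CU κU A₂U 𝒜 x z η Λ R := by
    refine hclip.trans (max_le hkU0 ?_)
    linarith
  have hI0 : 0 ≤ roughCellDensity (n + 1) (Real.log x / Real.log z) := roughCellDensity_nonneg _ _
  have hIu : roughCellDensity (n + 1) (Real.log x / Real.log z) ≤ (u : ℝ) + 1 :=
    (roughCellDensity_le (by omega) (by linarith)).trans hu'le
  have hpar := StepAux.parent_bound
    (ST := ∑ p ∈ P, roughCellDensity n (uu p) * (G * Vp p * Bp p / uu p))
    (Sπ := ∑ p ∈ P, roughCellDensity n (uu p) * πp p) (T := primeMain 𝒜 x z)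
    (C₁ := roughCellSum 𝒜 x z 1) (δ := cellDelta 𝒜 x z)
    (I := roughCellDensity (n + 1) (Real.log x / Real.log z))
    (cd := roughCellSum 𝒜 x z 1 - (2 - cellDelta 𝒜 x z) * primeMain 𝒜 x z) (by ring) hI0 n
  have hIcd : roughCellDensity (n + 1) (Real.log x / Real.log z) *
      |roughCellSum 𝒜 x z 1 - (2 - cellDelta 𝒜 x z) * primeMain 𝒜 x z| ≤
      ((u : ℝ) + 1) * kernelErr CU κU A₂U 𝒜 x z η Λ R :=
    mul_le_mul hIu hcd (abs_nonneg _) (by linarith)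
  /- the budget -/
  have hbudget := stub_stepBudget u 𝒜 x z η Λ R Cn C1 CF CM CP CU κ κn κ1 κP κU A₂n A₂1 AF A₂P A₂U hu hCn hC1
    hCF hCM hCP hCU hκpos hκn' hκ1' hκP' hκU' hκle1 hez hzx hlzlo hη0.le hη4 hΛ1 hΛx hVpos.le hA0 hR0
  /- assembly -/
  rw [hCdef]
  calc |roughCellSum 𝒜 x z (n + 1) -
        (1 + (cellDelta 𝒜 x z - 1) * (-1 : ℝ) ^ (n + 1)) * roughCellDensity (n + 1) (Real.log x / Real.log z) *
          primeMain 𝒜 x z|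
      ≤ |roughCellSum 𝒜 x z (n + 1) -
          ((1 + (-1 : ℝ) ^ n) * (∑ p ∈ P, roughCellDensity n (uu p) * (G * Vp p * Bp p / uu p)) -
            (-1 : ℝ) ^ n * (∑ p ∈ P, roughCellDensity n (uu p) * πp p))| +
        |(1 + (-1 : ℝ) ^ n) * (∑ p ∈ P, roughCellDensity n (uu p) * (G * Vp p * Bp p / uu p)) -
            (-1 : ℝ) ^ n * (∑ p ∈ P, roughCellDensity n (uu p) * πp p) -
          (1 + (cellDelta 𝒜 x z - 1) * (-1 : ℝ) ^ (n + 1)) * roughCellDensity (n + 1) (Real.log x / Real.log z) *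
            primeMain 𝒜 x z| := abs_sub_le _ _ _
    _ ≤ _ := by linarith [hF1, hpar, hMod', hP2', hIcd, hFSn, hFS1, hbudget]

end Summit.Parity.GeneralizedHardyLittlewood.Cruxes.CellParityLaw.SectionAnnihilator

end
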